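import Summits.QuantumFields.YangMills.Theorems.UnitScaleTiltProp7CovDPlaqKFast
import HarnessLib

/-!
# Route `UnitScaleTilt`, crux K1 «MinimiserStabilityRegPr» (stmt-QuantumFields-19200), route-R E′ growth side S3, K-FORM engine row R1 = hKg-K —
# THE SLOW∕FAST KNIT: `hKg-K ⟸ R1-SLOW + R1-FAST`.  If the SLOW part `s` of the Hodge potential `φ₀ = s + f` (spectral threshold split of `Δ_W` at `t`)
# obeys the displayed alignment row `K_W(D_W s) ≤ 𝓡`, then `K_W(D_W φ₀) ≤ 2𝓡 + 8a²d²t⁻¹·Σ_b|D_Wφ₀(b)|²_HS` — the fast half is ✓`Prop7CovDPlaqKFast` (R1-FAST),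
# the glue is the parallelogram bound for the door's four-term `ℒ_p` and the exact Dirichlet-energy splitting of the spectral split

Cell `ym3-torus`, width seat `ym3-torus-px12` (gen 4; lineage ✓`Prop7GaugeDirPlaqK` (g2) → ✓`Prop7CovDPlaqKFast` (g3, R1-FAST) → this file); namer ★ym-ust-19200-p1 g15
2026-08-28 21:04:46Z «R1 = hKg-K splits by kernel into R1-SLOW (displayed: the 3-mode alignment row, `C_g ≤ 1.3` numerically) + R1-FAST (theorem)».  THEOREMS ONLY
(0 `def`, 0 `sorry`); `--supports stmt-QuantumFields-19200 --as helper`, count-neutral.  YM₃ on T³ is a ladder rung (R3), not the Clay problem; nothing here claims the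
stub, the crux, d = 4 or the mass gap.

THE POINT (DESIGN-S3-KFORM-ENGINE-g15 R0∕R1; NUMERICS-19200-S3-CURVED-g15 §4 spectral-split diagnostic j317573).  The K-form engine displays ONE analytic row
`hKg-K : K_gauge(φ₀) := Σ_p‖ℒ_p(D_Wφ₀)‖² ≤ C_g·K_W(Y) + θ_g·e·ℓ⁻²M(Y)` for the covariant Hodge potential `φ₀` of an exactly `S_H`-gauged chart `Y`.  Numerically ALL of
`C_g` is carried by the slow sector of `Δ_W` (three modes at `t = a`), while the fast part is `e`-small by norms alone.  With ✓`Prop7CovLaplaceSpectralSplit.exists_slow_fast_siteField(_T3)`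
(`φ₀ = s + f`, energies splitting exactly) and ✓`Prop7CovDPlaqKFast.plaqK_covD_fast_le_pbond` (`K_W(D_Wf) ≤ 4a²d²t⁻¹Σ_b|D_Wf|²_HS`), the additivity of `φ ↦ ℒ_p(D_Wφ)` and
`‖A + B‖² ≤ 2‖A‖² + 2‖B‖²` give: the door may display the SLOW row `K_W(D_Ws) ≤ C_g·𝒦 + 𝓜` only, and recover `hKg-K` with `2C_g`, `2𝓜` and the extra junk
`8a²d²t⁻¹·Σ_b|D_Wφ₀|²_HS` — at `a = eℓ⁻²`, `t = c·a` this is `(8d²∕c)·e·ℓ⁻²·Σ_b|D_Wφ₀|²_HS ≤ (8d²∕c)·e·ℓ⁻²·Σ_b|Y|²_HS` by R0's `M(Y) = M(B) + M(D_Wφ₀)`: currency (eM).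

WHAT IS PROVED (ns `…Theorems.Prop7PlaqKSlowFastKnit`; any `P : Params`, level `i`, `SU(N)`; the four-term `ℒ_p` VERBATIM the letters of ✓`Prop7CovDPlaqKFast` ∕ ✓p666280 (S3)).
* §1 `linPart_add` (the four-term expression is additive in its four slots), `norm_add_sq_le` (`‖A+B‖² ≤ 2‖A‖²+2‖B‖²`), `covD_add_fun` (`D_W(s+f) = D_Ws + D_Wf`).
* §2 `linPlaq_add` (per plaquette `ℒ_p(D₁ + D₂) = ℒ_p(D₁) + ℒ_p(D₂)`), ★`plaqK_add_le` (`K_W(D₁ + D₂) ≤ 2K_W(D₁) + 2K_W(D₂)`), ★`plaqK_covD_add_le` (`K_W(D_W(s+f)) ≤ 2K_W(D_Ws) + 2K_W(D_Wf)`),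
  `linPlaq_neg`, ★`plaqK_sub_le` (`B = Y − D` ⇒ `K_W(B) ≤ 2K_W(Y) + 2K_W(D)` — the door's R1 «Consequence» for the co-closed Hodge part `B = Y − D_Wφ₀`).
* §3 ★★ `plaqK_covD_le_of_slowRow` — `dist1(W(∂p)) ≤ a`, `0 < t`, `φ₀ = s + f`, the fast row of `f` and the energy inequality `Σ_b|D_Wf|²_HS ≤ Σ_b|D_Wφ₀|²_HS` (⟸ the exact splitting),
  ONE displayed slow row `K_W(D_Ws) ≤ 𝓡`:  `K_W(D_Wφ₀) ≤ 2𝓡 + 8a²d²t⁻¹·Σ_b|D_Wφ₀(b)|²_HS`.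
* §4 ★★★ `hKgK_of_hKgK_slow_T3` — the T³ reading: for every run `K`, `SU(2)` background `W`, threshold `t > 0` and site field `φ₀` there are `s f` with `φ₀ = s + f`, the three exact
  splittings (mass, `D_W`-energy, `Δ_W`-energy) re-exported, the two SLOW rows of `s` (`Σ_b|D_Ws|² ≤ tΣ|s|²`, `Σ|Δ_Ws|² ≤ tΣ_b|D_Ws|²`) and the FAST row of `f`, such that every slow row
  `K_W(D_Ws) ≤ 𝓡` implies `K_W(D_Wφ₀) ≤ 2𝓡 + 8a²d²t⁻¹·Σ_b|D_Wφ₀|²_HS`.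
HONEST SCOPE.  Bookkeeping over landed theorems; the SLOW row (the alignment quantity `C_g`) is NOT proved here and stays the displayed analytic residue of S3; no window, no constant of
Bałaban's is asserted.

References: T. Bałaban, CMP 102 (1985) 277–309 [Balaban1985Variational] ((6) p.278, (47)–(48) pp.285–286, (141)–(143) p.299, Prop. 7 p.299); CMP 99 (1985) 389–434
[Balaban1985BackgroundPropagators] ((3.3)–(3.4) pp.390–391, (3.117)–(3.122) pp.419–420, Thm 3.11 p.416).
-/

set_option autoImplicit false

noncomputable section

open scoped BigOperators Matrix.Norms.L2Operator Matrix

namespace Summit.QuantumFields.YangMills.Theorems.Prop7PlaqKSlowFastKnit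

open Literature.MathematicalPhysics.QuantumFieldTheory.Balaban1983to89
open B9Eq39Adjoint (R R_add covD divB)
open B9TorusCalculus (torusT)
open B10Eq27TorusAxialLog (unitsField toUField)
open Summit.QuantumFields.YangMills.Theorems.Prop7CovDPlaqKFast (plaqK_covD_fast_le_pbond)
open Summit.QuantumFields.YangMills.Theorems.Prop7CovLaplaceSpectralSplit (exists_slow_fast_siteField_T3)

/-! ## §1 Algebra -/

section Algebra

variable {n : Type*} [Fintype n] [DecidableEq n]

omit [DecidableEq n] in
/-- The four-term expression `I•Z₁ + U·(I•Z₂)·U^* − Q·(I•Z₃)·Q^* − P₀·(I•Z₄)·P₀^*` is ADDITIVE in `(Z₁, Z₂, Z₃, Z₄)`. [folklore] -/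
theorem linPart_add (U Q P₀ A₁ A₂ A₃ A₄ B₁ B₂ B₃ B₄ : Matrix n n ℂ) :
    Complex.I • (A₁ + B₁) + U * (Complex.I • (A₂ + B₂)) * star U - Q * (Complex.I • (A₃ + B₃)) * star Q - P₀ * (Complex.I • (A₄ + B₄)) * star P₀
      = (Complex.I • A₁ + U * (Complex.I • A₂) * star U - Q * (Complex.I • A₃) * star Q - P₀ * (Complex.I • A₄) * star P₀)
        + (Complex.I • B₁ + U * (Complex.I • B₂) * star U - Q * (Complex.I • B₃) * star Q - P₀ * (Complex.I • B₄) * star P₀) := by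
  simp only [smul_add, Matrix.mul_add, Matrix.add_mul]
  abel

end Algebra

/-- `‖A + B‖² ≤ 2‖A‖² + 2‖B‖²` in any seminormed group. [folklore] -/
theorem norm_add_sq_le {E : Type*} [SeminormedAddCommGroup E] (A B : E) : ‖A + B‖ ^ 2 ≤ 2 * ‖A‖ ^ 2 + 2 * ‖B‖ ^ 2 := by
  have h := norm_add_le A B
  have hA := norm_nonneg A
  have hB := norm_nonneg B
  nlinarith [sq_nonneg (‖A‖ - ‖B‖), norm_nonneg (A + B)]

section RingLevel

variable {𝔸 : Type*} [Ring 𝔸] {S : Type*} {ι : Type*} (T : ι → Equiv.Perm S) (U : ι → S → 𝔸ˣ)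

/-- `D_U(s + f) = D_Us + D_Uf` (the covariant derivative (3.3) is additive). [cite: Balaban1985BackgroundPropagators, (3.3) p.390] -/
theorem covD_add_fun (μ : ι) (s f : S → 𝔸) (x : S) :
    covD T U μ (fun z => s z + f z) x = covD T U μ s x + covD T U μ f x := by
  simp only [covD, R_add]
  abel

end RingLevel

/-! ## §2 On the lattice: additivity of the door's `ℒ_p` and the parallelogram bound for `K_W` -/

section Lattice

variable {P : Params} {i : ℕ} {N : ℕ} [NeZero N]

/-- **`ℒ_p(D₁ + D₂) = ℒ_p(D₁) + ℒ_p(D₂)`** per plaquette, the four-term `ℒ_p` VERBATIM the (S3) letters. [cite: Balaban1985BackgroundPropagators, (3.4) p.391] -/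
theorem linPlaq_add (W : GaugeField P i (Matrix.specialUnitaryGroup (Fin N) ℂ)) (D D₁ D₂ : PBond P i → Matrix (Fin N) (Fin N) ℂ)
    (hD : ∀ b : PBond P i, D b = D₁ b + D₂ b) (p : Plaq P i) :
    ((Complex.I • D ⟨p.src, p.μ⟩)
        + ((W ⟨p.src, p.μ⟩ : Matrix (Fin N) (Fin N) ℂ) * (Complex.I • D ⟨p.src.shift p.μ, p.ν⟩) * star (W ⟨p.src, p.μ⟩ : Matrix (Fin N) (Fin N) ℂ))
        - (((W ⟨p.src, p.μ⟩ * W ⟨p.src.shift p.μ, p.ν⟩ * (W ⟨p.src.shift p.ν, p.μ⟩)⁻¹ : Matrix.specialUnitaryGroup (Fin N) ℂ) : Matrix (Fin N) (Fin N) ℂ)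
            * (Complex.I • D ⟨p.src.shift p.ν, p.μ⟩)
            * star ((W ⟨p.src, p.μ⟩ * W ⟨p.src.shift p.μ, p.ν⟩ * (W ⟨p.src.shift p.ν, p.μ⟩)⁻¹ : Matrix.specialUnitaryGroup (Fin N) ℂ) : Matrix (Fin N) (Fin N) ℂ))
        - (((GaugeField.plaqHol W p : Matrix.specialUnitaryGroup (Fin N) ℂ) : Matrix (Fin N) (Fin N) ℂ) * (Complex.I • D ⟨p.src, p.ν⟩)
            * star ((GaugeField.plaqHol W p : Matrix.specialUnitaryGroup (Fin N) ℂ) : Matrix (Fin N) (Fin N) ℂ)))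
      = ((Complex.I • D₁ ⟨p.src, p.μ⟩)
        + ((W ⟨p.src, p.μ⟩ : Matrix (Fin N) (Fin N) ℂ) * (Complex.I • D₁ ⟨p.src.shift p.μ, p.ν⟩) * star (W ⟨p.src, p.μ⟩ : Matrix (Fin N) (Fin N) ℂ))
        - (((W ⟨p.src, p.μ⟩ * W ⟨p.src.shift p.μ, p.ν⟩ * (W ⟨p.src.shift p.ν, p.μ⟩)⁻¹ : Matrix.specialUnitaryGroup (Fin N) ℂ) : Matrix (Fin N) (Fin N) ℂ)
            * (Complex.I • D₁ ⟨p.src.shift p.ν, p.μ⟩)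
            * star ((W ⟨p.src, p.μ⟩ * W ⟨p.src.shift p.μ, p.ν⟩ * (W ⟨p.src.shift p.ν, p.μ⟩)⁻¹ : Matrix.specialUnitaryGroup (Fin N) ℂ) : Matrix (Fin N) (Fin N) ℂ))
        - (((GaugeField.plaqHol W p : Matrix.specialUnitaryGroup (Fin N) ℂ) : Matrix (Fin N) (Fin N) ℂ) * (Complex.I • D₁ ⟨p.src, p.ν⟩)
            * star ((GaugeField.plaqHol W p : Matrix.specialUnitaryGroup (Fin N) ℂ) : Matrix (Fin N) (Fin N) ℂ)))
      + ((Complex.I • D₂ ⟨p.src, p.μ⟩)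
        + ((W ⟨p.src, p.μ⟩ : Matrix (Fin N) (Fin N) ℂ) * (Complex.I • D₂ ⟨p.src.shift p.μ, p.ν⟩) * star (W ⟨p.src, p.μ⟩ : Matrix (Fin N) (Fin N) ℂ))
        - (((W ⟨p.src, p.μ⟩ * W ⟨p.src.shift p.μ, p.ν⟩ * (W ⟨p.src.shift p.ν, p.μ⟩)⁻¹ : Matrix.specialUnitaryGroup (Fin N) ℂ) : Matrix (Fin N) (Fin N) ℂ)
            * (Complex.I • D₂ ⟨p.src.shift p.ν, p.μ⟩)
            * star ((W ⟨p.src, p.μ⟩ * W ⟨p.src.shift p.μ, p.ν⟩ * (W ⟨p.src.shift p.ν, p.μ⟩)⁻¹ : Matrix.specialUnitaryGroup (Fin N) ℂ) : Matrix (Fin N) (Fin N) ℂ))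
        - (((GaugeField.plaqHol W p : Matrix.specialUnitaryGroup (Fin N) ℂ) : Matrix (Fin N) (Fin N) ℂ) * (Complex.I • D₂ ⟨p.src, p.ν⟩)
            * star ((GaugeField.plaqHol W p : Matrix.specialUnitaryGroup (Fin N) ℂ) : Matrix (Fin N) (Fin N) ℂ))) := by
  simp only [hD]
  exact linPart_add _ _ _ _ _ _ _ _ _ _ _

/-- ★ **PARALLELOGRAM BOUND FOR THE DOOR's `K_W`**: `K_W(D₁ + D₂) ≤ 2K_W(D₁) + 2K_W(D₂)` (any background `W`, any bond fields). [folklore] -/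
theorem plaqK_add_le (W : GaugeField P i (Matrix.specialUnitaryGroup (Fin N) ℂ)) (D D₁ D₂ : PBond P i → Matrix (Fin N) (Fin N) ℂ)
    (hD : ∀ b : PBond P i, D b = D₁ b + D₂ b) :
    (∑ p : Plaq P i, ‖((Complex.I • D ⟨p.src, p.μ⟩)
          + ((W ⟨p.src, p.μ⟩ : Matrix (Fin N) (Fin N) ℂ) * (Complex.I • D ⟨p.src.shift p.μ, p.ν⟩) * star (W ⟨p.src, p.μ⟩ : Matrix (Fin N) (Fin N) ℂ))
          - (((W ⟨p.src, p.μ⟩ * W ⟨p.src.shift p.μ, p.ν⟩ * (W ⟨p.src.shift p.ν, p.μ⟩)⁻¹ : Matrix.specialUnitaryGroup (Fin N) ℂ) : Matrix (Fin N) (Fin N) ℂ)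
              * (Complex.I • D ⟨p.src.shift p.ν, p.μ⟩)
              * star ((W ⟨p.src, p.μ⟩ * W ⟨p.src.shift p.μ, p.ν⟩ * (W ⟨p.src.shift p.ν, p.μ⟩)⁻¹ : Matrix.specialUnitaryGroup (Fin N) ℂ) : Matrix (Fin N) (Fin N) ℂ))
          - (((GaugeField.plaqHol W p : Matrix.specialUnitaryGroup (Fin N) ℂ) : Matrix (Fin N) (Fin N) ℂ) * (Complex.I • D ⟨p.src, p.ν⟩)
              * star ((GaugeField.plaqHol W p : Matrix.specialUnitaryGroup (Fin N) ℂ) : Matrix (Fin N) (Fin N) ℂ)))‖ ^ 2)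
      ≤ 2 * (∑ p : Plaq P i, ‖((Complex.I • D₁ ⟨p.src, p.μ⟩)
          + ((W ⟨p.src, p.μ⟩ : Matrix (Fin N) (Fin N) ℂ) * (Complex.I • D₁ ⟨p.src.shift p.μ, p.ν⟩) * star (W ⟨p.src, p.μ⟩ : Matrix (Fin N) (Fin N) ℂ))
          - (((W ⟨p.src, p.μ⟩ * W ⟨p.src.shift p.μ, p.ν⟩ * (W ⟨p.src.shift p.ν, p.μ⟩)⁻¹ : Matrix.specialUnitaryGroup (Fin N) ℂ) : Matrix (Fin N) (Fin N) ℂ)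
              * (Complex.I • D₁ ⟨p.src.shift p.ν, p.μ⟩)
              * star ((W ⟨p.src, p.μ⟩ * W ⟨p.src.shift p.μ, p.ν⟩ * (W ⟨p.src.shift p.ν, p.μ⟩)⁻¹ : Matrix.specialUnitaryGroup (Fin N) ℂ) : Matrix (Fin N) (Fin N) ℂ))
          - (((GaugeField.plaqHol W p : Matrix.specialUnitaryGroup (Fin N) ℂ) : Matrix (Fin N) (Fin N) ℂ) * (Complex.I • D₁ ⟨p.src, p.ν⟩)
              * star ((GaugeField.plaqHol W p : Matrix.specialUnitaryGroup (Fin N) ℂ) : Matrix (Fin N) (Fin N) ℂ)))‖ ^ 2)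
        + 2 * (∑ p : Plaq P i, ‖((Complex.I • D₂ ⟨p.src, p.μ⟩)
          + ((W ⟨p.src, p.μ⟩ : Matrix (Fin N) (Fin N) ℂ) * (Complex.I • D₂ ⟨p.src.shift p.μ, p.ν⟩) * star (W ⟨p.src, p.μ⟩ : Matrix (Fin N) (Fin N) ℂ))
          - (((W ⟨p.src, p.μ⟩ * W ⟨p.src.shift p.μ, p.ν⟩ * (W ⟨p.src.shift p.ν, p.μ⟩)⁻¹ : Matrix.specialUnitaryGroup (Fin N) ℂ) : Matrix (Fin N) (Fin N) ℂ)
              * (Complex.I • D₂ ⟨p.src.shift p.ν, p.μ⟩)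
              * star ((W ⟨p.src, p.μ⟩ * W ⟨p.src.shift p.μ, p.ν⟩ * (W ⟨p.src.shift p.ν, p.μ⟩)⁻¹ : Matrix.specialUnitaryGroup (Fin N) ℂ) : Matrix (Fin N) (Fin N) ℂ))
          - (((GaugeField.plaqHol W p : Matrix.specialUnitaryGroup (Fin N) ℂ) : Matrix (Fin N) (Fin N) ℂ) * (Complex.I • D₂ ⟨p.src, p.ν⟩)
              * star ((GaugeField.plaqHol W p : Matrix.specialUnitaryGroup (Fin N) ℂ) : Matrix (Fin N) (Fin N) ℂ)))‖ ^ 2) := by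
  rw [Finset.mul_sum, Finset.mul_sum, ← Finset.sum_add_distrib]
  refine Finset.sum_le_sum fun p _ => ?_
  rw [linPlaq_add W D D₁ D₂ hD p]
  exact norm_add_sq_le _ _

/-- ★ **`K_W(D_W(s + f)) ≤ 2K_W(D_Ws) + 2K_W(D_Wf)`** for site fields `s f` and `φ₀ = s + f`, `D_W = covD (torusT P i) (unitsField ∘ toUField W)`.
[cite: Balaban1985BackgroundPropagators, (3.3)-(3.4) pp.390-391] -/
theorem plaqK_covD_add_le (W : GaugeField P i (Matrix.specialUnitaryGroup (Fin N) ℂ)) (φ₀ s f : Site P i → Matrix (Fin N) (Fin N) ℂ)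
    (hφ : ∀ x, φ₀ x = s x + f x)
    (D Ds Df : PBond P i → Matrix (Fin N) (Fin N) ℂ)
    (hD : ∀ b : PBond P i, D b = covD (torusT P i) (fun κ z => unitsField (toUField W) ⟨z, κ⟩) b.dir φ₀ b.src)
    (hDs : ∀ b : PBond P i, Ds b = covD (torusT P i) (fun κ z => unitsField (toUField W) ⟨z, κ⟩) b.dir s b.src)
    (hDf : ∀ b : PBond P i, Df b = covD (torusT P i) (fun κ z => unitsField (toUField W) ⟨z, κ⟩) b.dir f b.src) :
    (∑ p : Plaq P i, ‖((Complex.I • D ⟨p.src, p.μ⟩)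
          + ((W ⟨p.src, p.μ⟩ : Matrix (Fin N) (Fin N) ℂ) * (Complex.I • D ⟨p.src.shift p.μ, p.ν⟩) * star (W ⟨p.src, p.μ⟩ : Matrix (Fin N) (Fin N) ℂ))
          - (((W ⟨p.src, p.μ⟩ * W ⟨p.src.shift p.μ, p.ν⟩ * (W ⟨p.src.shift p.ν, p.μ⟩)⁻¹ : Matrix.specialUnitaryGroup (Fin N) ℂ) : Matrix (Fin N) (Fin N) ℂ)
              * (Complex.I • D ⟨p.src.shift p.ν, p.μ⟩)
              * star ((W ⟨p.src, p.μ⟩ * W ⟨p.src.shift p.μ, p.ν⟩ * (W ⟨p.src.shift p.ν, p.μ⟩)⁻¹ : Matrix.specialUnitaryGroup (Fin N) ℂ) : Matrix (Fin N) (Fin N) ℂ))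
          - (((GaugeField.plaqHol W p : Matrix.specialUnitaryGroup (Fin N) ℂ) : Matrix (Fin N) (Fin N) ℂ) * (Complex.I • D ⟨p.src, p.ν⟩)
              * star ((GaugeField.plaqHol W p : Matrix.specialUnitaryGroup (Fin N) ℂ) : Matrix (Fin N) (Fin N) ℂ)))‖ ^ 2)
      ≤ 2 * (∑ p : Plaq P i, ‖((Complex.I • Ds ⟨p.src, p.μ⟩)
          + ((W ⟨p.src, p.μ⟩ : Matrix (Fin N) (Fin N) ℂ) * (Complex.I • Ds ⟨p.src.shift p.μ, p.ν⟩) * star (W ⟨p.src, p.μ⟩ : Matrix (Fin N) (Fin N) ℂ))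
          - (((W ⟨p.src, p.μ⟩ * W ⟨p.src.shift p.μ, p.ν⟩ * (W ⟨p.src.shift p.ν, p.μ⟩)⁻¹ : Matrix.specialUnitaryGroup (Fin N) ℂ) : Matrix (Fin N) (Fin N) ℂ)
              * (Complex.I • Ds ⟨p.src.shift p.ν, p.μ⟩)
              * star ((W ⟨p.src, p.μ⟩ * W ⟨p.src.shift p.μ, p.ν⟩ * (W ⟨p.src.shift p.ν, p.μ⟩)⁻¹ : Matrix.specialUnitaryGroup (Fin N) ℂ) : Matrix (Fin N) (Fin N) ℂ))
          - (((GaugeField.plaqHol W p : Matrix.specialUnitaryGroup (Fin N) ℂ) : Matrix (Fin N) (Fin N) ℂ) * (Complex.I • Ds ⟨p.src, p.ν⟩)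
              * star ((GaugeField.plaqHol W p : Matrix.specialUnitaryGroup (Fin N) ℂ) : Matrix (Fin N) (Fin N) ℂ)))‖ ^ 2)
        + 2 * (∑ p : Plaq P i, ‖((Complex.I • Df ⟨p.src, p.μ⟩)
          + ((W ⟨p.src, p.μ⟩ : Matrix (Fin N) (Fin N) ℂ) * (Complex.I • Df ⟨p.src.shift p.μ, p.ν⟩) * star (W ⟨p.src, p.μ⟩ : Matrix (Fin N) (Fin N) ℂ))
          - (((W ⟨p.src, p.μ⟩ * W ⟨p.src.shift p.μ, p.ν⟩ * (W ⟨p.src.shift p.ν, p.μ⟩)⁻¹ : Matrix.specialUnitaryGroup (Fin N) ℂ) : Matrix (Fin N) (Fin N) ℂ)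
              * (Complex.I • Df ⟨p.src.shift p.ν, p.μ⟩)
              * star ((W ⟨p.src, p.μ⟩ * W ⟨p.src.shift p.μ, p.ν⟩ * (W ⟨p.src.shift p.ν, p.μ⟩)⁻¹ : Matrix.specialUnitaryGroup (Fin N) ℂ) : Matrix (Fin N) (Fin N) ℂ))
          - (((GaugeField.plaqHol W p : Matrix.specialUnitaryGroup (Fin N) ℂ) : Matrix (Fin N) (Fin N) ℂ) * (Complex.I • Df ⟨p.src, p.ν⟩)
              * star ((GaugeField.plaqHol W p : Matrix.specialUnitaryGroup (Fin N) ℂ) : Matrix (Fin N) (Fin N) ℂ)))‖ ^ 2) := by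
  refine plaqK_add_le W D Ds Df fun b => ?_
  rw [hD, hDs, hDf]
  have e : φ₀ = fun z => s z + f z := funext hφ
  rw [e]
  exact covD_add_fun _ _ b.dir s f b.src

/-- **`ℒ_p(−D) = −ℒ_p(D)`** per plaquette (`K_W` is even). [cite: Balaban1985BackgroundPropagators, (3.4) p.391] -/
theorem linPlaq_neg (W : GaugeField P i (Matrix.specialUnitaryGroup (Fin N) ℂ)) (D Dn : PBond P i → Matrix (Fin N) (Fin N) ℂ)
    (hDn : ∀ b : PBond P i, Dn b = -D b) (p : Plaq P i) :
    ((Complex.I • Dn ⟨p.src, p.μ⟩)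
          + ((W ⟨p.src, p.μ⟩ : Matrix (Fin N) (Fin N) ℂ) * (Complex.I • Dn ⟨p.src.shift p.μ, p.ν⟩) * star (W ⟨p.src, p.μ⟩ : Matrix (Fin N) (Fin N) ℂ))
          - (((W ⟨p.src, p.μ⟩ * W ⟨p.src.shift p.μ, p.ν⟩ * (W ⟨p.src.shift p.ν, p.μ⟩)⁻¹ : Matrix.specialUnitaryGroup (Fin N) ℂ) : Matrix (Fin N) (Fin N) ℂ)
              * (Complex.I • Dn ⟨p.src.shift p.ν, p.μ⟩)
              * star ((W ⟨p.src, p.μ⟩ * W ⟨p.src.shift p.μ, p.ν⟩ * (W ⟨p.src.shift p.ν, p.μ⟩)⁻¹ : Matrix.specialUnitaryGroup (Fin N) ℂ) : Matrix (Fin N) (Fin N) ℂ))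
          - (((GaugeField.plaqHol W p : Matrix.specialUnitaryGroup (Fin N) ℂ) : Matrix (Fin N) (Fin N) ℂ) * (Complex.I • Dn ⟨p.src, p.ν⟩)
              * star ((GaugeField.plaqHol W p : Matrix.specialUnitaryGroup (Fin N) ℂ) : Matrix (Fin N) (Fin N) ℂ)))
      = -((Complex.I • D ⟨p.src, p.μ⟩)
          + ((W ⟨p.src, p.μ⟩ : Matrix (Fin N) (Fin N) ℂ) * (Complex.I • D ⟨p.src.shift p.μ, p.ν⟩) * star (W ⟨p.src, p.μ⟩ : Matrix (Fin N) (Fin N) ℂ))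
          - (((W ⟨p.src, p.μ⟩ * W ⟨p.src.shift p.μ, p.ν⟩ * (W ⟨p.src.shift p.ν, p.μ⟩)⁻¹ : Matrix.specialUnitaryGroup (Fin N) ℂ) : Matrix (Fin N) (Fin N) ℂ)
              * (Complex.I • D ⟨p.src.shift p.ν, p.μ⟩)
              * star ((W ⟨p.src, p.μ⟩ * W ⟨p.src.shift p.μ, p.ν⟩ * (W ⟨p.src.shift p.ν, p.μ⟩)⁻¹ : Matrix.specialUnitaryGroup (Fin N) ℂ) : Matrix (Fin N) (Fin N) ℂ))
          - (((GaugeField.plaqHol W p : Matrix.specialUnitaryGroup (Fin N) ℂ) : Matrix (Fin N) (Fin N) ℂ) * (Complex.I • D ⟨p.src, p.ν⟩)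
              * star ((GaugeField.plaqHol W p : Matrix.specialUnitaryGroup (Fin N) ℂ) : Matrix (Fin N) (Fin N) ℂ))) := by
  simp only [hDn, smul_neg, Matrix.mul_neg, Matrix.neg_mul]
  abel

/-- ★ **THE DOOR's R1 CONSEQUENCE FOR THE CO-CLOSED HODGE PART**: if `B = Y − D` bondwise (at the door `D := D_Wφ₀`, `B` the co-closed part of R0's covariant Hodge split
`Y = B + D_Wφ₀`), then `K_W(B) ≤ 2K_W(Y) + 2K_W(D)` — with R1 `K_W(D_Wφ₀) = K_gauge(φ₀) ≤ C_g·K_W(Y) + …` this is `K_W(B) ≤ 2(1 + C_g)·K_W(Y) + …` (DESIGN-S3-KFORM-ENGINE-g15, R1 «Consequence»).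
[cite: Balaban1985Variational, (141)-(143) p.299; Balaban1985BackgroundPropagators, (3.4) p.391, (3.117)-(3.122) pp.419-420] -/
theorem plaqK_sub_le (W : GaugeField P i (Matrix.specialUnitaryGroup (Fin N) ℂ)) (B Y D : PBond P i → Matrix (Fin N) (Fin N) ℂ)
    (hB : ∀ b : PBond P i, B b = Y b - D b) :
    (∑ p : Plaq P i, ‖((Complex.I • B ⟨p.src, p.μ⟩)
          + ((W ⟨p.src, p.μ⟩ : Matrix (Fin N) (Fin N) ℂ) * (Complex.I • B ⟨p.src.shift p.μ, p.ν⟩) * star (W ⟨p.src, p.μ⟩ : Matrix (Fin N) (Fin N) ℂ))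
          - (((W ⟨p.src, p.μ⟩ * W ⟨p.src.shift p.μ, p.ν⟩ * (W ⟨p.src.shift p.ν, p.μ⟩)⁻¹ : Matrix.specialUnitaryGroup (Fin N) ℂ) : Matrix (Fin N) (Fin N) ℂ)
              * (Complex.I • B ⟨p.src.shift p.ν, p.μ⟩)
              * star ((W ⟨p.src, p.μ⟩ * W ⟨p.src.shift p.μ, p.ν⟩ * (W ⟨p.src.shift p.ν, p.μ⟩)⁻¹ : Matrix.specialUnitaryGroup (Fin N) ℂ) : Matrix (Fin N) (Fin N) ℂ))
          - (((GaugeField.plaqHol W p : Matrix.specialUnitaryGroup (Fin N) ℂ) : Matrix (Fin N) (Fin N) ℂ) * (Complex.I • B ⟨p.src, p.ν⟩)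
              * star ((GaugeField.plaqHol W p : Matrix.specialUnitaryGroup (Fin N) ℂ) : Matrix (Fin N) (Fin N) ℂ)))‖ ^ 2)
      ≤ 2 * (∑ p : Plaq P i, ‖((Complex.I • Y ⟨p.src, p.μ⟩)
          + ((W ⟨p.src, p.μ⟩ : Matrix (Fin N) (Fin N) ℂ) * (Complex.I • Y ⟨p.src.shift p.μ, p.ν⟩) * star (W ⟨p.src, p.μ⟩ : Matrix (Fin N) (Fin N) ℂ))
          - (((W ⟨p.src, p.μ⟩ * W ⟨p.src.shift p.μ, p.ν⟩ * (W ⟨p.src.shift p.ν, p.μ⟩)⁻¹ : Matrix.specialUnitaryGroup (Fin N) ℂ) : Matrix (Fin N) (Fin N) ℂ)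
              * (Complex.I • Y ⟨p.src.shift p.ν, p.μ⟩)
              * star ((W ⟨p.src, p.μ⟩ * W ⟨p.src.shift p.μ, p.ν⟩ * (W ⟨p.src.shift p.ν, p.μ⟩)⁻¹ : Matrix.specialUnitaryGroup (Fin N) ℂ) : Matrix (Fin N) (Fin N) ℂ))
          - (((GaugeField.plaqHol W p : Matrix.specialUnitaryGroup (Fin N) ℂ) : Matrix (Fin N) (Fin N) ℂ) * (Complex.I • Y ⟨p.src, p.ν⟩)
              * star ((GaugeField.plaqHol W p : Matrix.specialUnitaryGroup (Fin N) ℂ) : Matrix (Fin N) (Fin N) ℂ)))‖ ^ 2)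
        + 2 * (∑ p : Plaq P i, ‖((Complex.I • D ⟨p.src, p.μ⟩)
          + ((W ⟨p.src, p.μ⟩ : Matrix (Fin N) (Fin N) ℂ) * (Complex.I • D ⟨p.src.shift p.μ, p.ν⟩) * star (W ⟨p.src, p.μ⟩ : Matrix (Fin N) (Fin N) ℂ))
          - (((W ⟨p.src, p.μ⟩ * W ⟨p.src.shift p.μ, p.ν⟩ * (W ⟨p.src.shift p.ν, p.μ⟩)⁻¹ : Matrix.specialUnitaryGroup (Fin N) ℂ) : Matrix (Fin N) (Fin N) ℂ)
              * (Complex.I • D ⟨p.src.shift p.ν, p.μ⟩)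
              * star ((W ⟨p.src, p.μ⟩ * W ⟨p.src.shift p.μ, p.ν⟩ * (W ⟨p.src.shift p.ν, p.μ⟩)⁻¹ : Matrix.specialUnitaryGroup (Fin N) ℂ) : Matrix (Fin N) (Fin N) ℂ))
          - (((GaugeField.plaqHol W p : Matrix.specialUnitaryGroup (Fin N) ℂ) : Matrix (Fin N) (Fin N) ℂ) * (Complex.I • D ⟨p.src, p.ν⟩)
              * star ((GaugeField.plaqHol W p : Matrix.specialUnitaryGroup (Fin N) ℂ) : Matrix (Fin N) (Fin N) ℂ)))‖ ^ 2) := by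
  have h := plaqK_add_le W B Y (fun b => -D b) (fun b => by rw [hB]; exact sub_eq_add_neg _ _)
  have e : ∀ p : Plaq P i, ‖((Complex.I • (fun b => -D b) ⟨p.src, p.μ⟩)
          + ((W ⟨p.src, p.μ⟩ : Matrix (Fin N) (Fin N) ℂ) * (Complex.I • (fun b => -D b) ⟨p.src.shift p.μ, p.ν⟩) * star (W ⟨p.src, p.μ⟩ : Matrix (Fin N) (Fin N) ℂ))
          - (((W ⟨p.src, p.μ⟩ * W ⟨p.src.shift p.μ, p.ν⟩ * (W ⟨p.src.shift p.ν, p.μ⟩)⁻¹ : Matrix.specialUnitaryGroup (Fin N) ℂ) : Matrix (Fin N) (Fin N) ℂ)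
              * (Complex.I • (fun b => -D b) ⟨p.src.shift p.ν, p.μ⟩)
              * star ((W ⟨p.src, p.μ⟩ * W ⟨p.src.shift p.μ, p.ν⟩ * (W ⟨p.src.shift p.ν, p.μ⟩)⁻¹ : Matrix.specialUnitaryGroup (Fin N) ℂ) : Matrix (Fin N) (Fin N) ℂ))
          - (((GaugeField.plaqHol W p : Matrix.specialUnitaryGroup (Fin N) ℂ) : Matrix (Fin N) (Fin N) ℂ) * (Complex.I • (fun b => -D b) ⟨p.src, p.ν⟩)
              * star ((GaugeField.plaqHol W p : Matrix.specialUnitaryGroup (Fin N) ℂ) : Matrix (Fin N) (Fin N) ℂ)))‖ ^ 2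
      = ‖((Complex.I • D ⟨p.src, p.μ⟩)
          + ((W ⟨p.src, p.μ⟩ : Matrix (Fin N) (Fin N) ℂ) * (Complex.I • D ⟨p.src.shift p.μ, p.ν⟩) * star (W ⟨p.src, p.μ⟩ : Matrix (Fin N) (Fin N) ℂ))
          - (((W ⟨p.src, p.μ⟩ * W ⟨p.src.shift p.μ, p.ν⟩ * (W ⟨p.src.shift p.ν, p.μ⟩)⁻¹ : Matrix.specialUnitaryGroup (Fin N) ℂ) : Matrix (Fin N) (Fin N) ℂ)
              * (Complex.I • D ⟨p.src.shift p.ν, p.μ⟩)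
              * star ((W ⟨p.src, p.μ⟩ * W ⟨p.src.shift p.μ, p.ν⟩ * (W ⟨p.src.shift p.ν, p.μ⟩)⁻¹ : Matrix.specialUnitaryGroup (Fin N) ℂ) : Matrix (Fin N) (Fin N) ℂ))
          - (((GaugeField.plaqHol W p : Matrix.specialUnitaryGroup (Fin N) ℂ) : Matrix (Fin N) (Fin N) ℂ) * (Complex.I • D ⟨p.src, p.ν⟩)
              * star ((GaugeField.plaqHol W p : Matrix.specialUnitaryGroup (Fin N) ℂ) : Matrix (Fin N) (Fin N) ℂ)))‖ ^ 2 := by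
    intro p
    rw [linPlaq_neg W D (fun b => -D b) (fun b => rfl) p, norm_neg]
  simp only [e] at h
  exact h

/-! ## §3 ★★ `hKg-K` from the SLOW row: the fast half is ✓`Prop7CovDPlaqKFast` -/

/-- ★★ **R1 ⟸ R1-SLOW + R1-FAST.**  Background `W` with the plaquette clause `dist1(W(∂p)) ≤ a`; threshold `t > 0`; a site field `φ₀ = s + f` whose FAST part obeys
`t·Σ|f|²_HS ≤ Σ_b|D_Wf|²_HS` and whose Dirichlet energies satisfy `Σ_b|D_Wf|²_HS ≤ Σ_b|D_Wφ₀|²_HS` (⟸ the exact splitting of ✓`exists_slow_fast_siteField_T3`); ONE displayed slow row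
`K_W(D_Ws) ≤ 𝓡`.  Then `K_W(D_Wφ₀) ≤ 2𝓡 + 8a²d²t⁻¹·Σ_b|D_Wφ₀(b)|²_HS`.  At `a = eℓ⁻²`, `t = c·a` the junk is `(8d²∕c)·e·ℓ⁻²·Σ_b|D_Wφ₀|²_HS` — currency (eM).
[cite: Balaban1985Variational, (6) p.278, (47)-(48) pp.285-286, (141)-(143) p.299; Balaban1985BackgroundPropagators, (3.4) p.391, (3.117)-(3.122) pp.419-420] -/
theorem plaqK_covD_le_of_slowRow (W : GaugeField P i (Matrix.specialUnitaryGroup (Fin N) ℂ)) {a t 𝓡 : ℝ}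
    (hW : ∀ p : Plaq P i, dist1 (GaugeField.plaqHol W p) ≤ a) (ht : 0 < t)
    (φ₀ s f : Site P i → Matrix (Fin N) (Fin N) ℂ) (hφ : ∀ x, φ₀ x = s x + f x)
    (hfast : t * ∑ x : Site P i, ∑ a : Fin N, ∑ b : Fin N, Complex.normSq (f x a b)
      ≤ ∑ b : PBond P i, ∑ a : Fin N, ∑ b' : Fin N,
          Complex.normSq (covD (torusT P i) (fun κ z => unitsField (toUField W) ⟨z, κ⟩) b.dir f b.src a b'))
    (hen : ∑ b : PBond P i, ∑ a : Fin N, ∑ b' : Fin N, Complex.normSq (covD (torusT P i) (fun κ z => unitsField (toUField W) ⟨z, κ⟩) b.dir f b.src a b')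
      ≤ ∑ b : PBond P i, ∑ a : Fin N, ∑ b' : Fin N, Complex.normSq (covD (torusT P i) (fun κ z => unitsField (toUField W) ⟨z, κ⟩) b.dir φ₀ b.src a b'))
    (D Ds : PBond P i → Matrix (Fin N) (Fin N) ℂ)
    (hD : ∀ b : PBond P i, D b = covD (torusT P i) (fun κ z => unitsField (toUField W) ⟨z, κ⟩) b.dir φ₀ b.src)
    (hDs : ∀ b : PBond P i, Ds b = covD (torusT P i) (fun κ z => unitsField (toUField W) ⟨z, κ⟩) b.dir s b.src)
    (hslow : (∑ p : Plaq P i, ‖((Complex.I • Ds ⟨p.src, p.μ⟩)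
          + ((W ⟨p.src, p.μ⟩ : Matrix (Fin N) (Fin N) ℂ) * (Complex.I • Ds ⟨p.src.shift p.μ, p.ν⟩) * star (W ⟨p.src, p.μ⟩ : Matrix (Fin N) (Fin N) ℂ))
          - (((W ⟨p.src, p.μ⟩ * W ⟨p.src.shift p.μ, p.ν⟩ * (W ⟨p.src.shift p.ν, p.μ⟩)⁻¹ : Matrix.specialUnitaryGroup (Fin N) ℂ) : Matrix (Fin N) (Fin N) ℂ)
              * (Complex.I • Ds ⟨p.src.shift p.ν, p.μ⟩)
              * star ((W ⟨p.src, p.μ⟩ * W ⟨p.src.shift p.μ, p.ν⟩ * (W ⟨p.src.shift p.ν, p.μ⟩)⁻¹ : Matrix.specialUnitaryGroup (Fin N) ℂ) : Matrix (Fin N) (Fin N) ℂ))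
          - (((GaugeField.plaqHol W p : Matrix.specialUnitaryGroup (Fin N) ℂ) : Matrix (Fin N) (Fin N) ℂ) * (Complex.I • Ds ⟨p.src, p.ν⟩)
              * star ((GaugeField.plaqHol W p : Matrix.specialUnitaryGroup (Fin N) ℂ) : Matrix (Fin N) (Fin N) ℂ)))‖ ^ 2) ≤ 𝓡) :
    (∑ p : Plaq P i, ‖((Complex.I • D ⟨p.src, p.μ⟩)
          + ((W ⟨p.src, p.μ⟩ : Matrix (Fin N) (Fin N) ℂ) * (Complex.I • D ⟨p.src.shift p.μ, p.ν⟩) * star (W ⟨p.src, p.μ⟩ : Matrix (Fin N) (Fin N) ℂ))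
          - (((W ⟨p.src, p.μ⟩ * W ⟨p.src.shift p.μ, p.ν⟩ * (W ⟨p.src.shift p.ν, p.μ⟩)⁻¹ : Matrix.specialUnitaryGroup (Fin N) ℂ) : Matrix (Fin N) (Fin N) ℂ)
              * (Complex.I • D ⟨p.src.shift p.ν, p.μ⟩)
              * star ((W ⟨p.src, p.μ⟩ * W ⟨p.src.shift p.μ, p.ν⟩ * (W ⟨p.src.shift p.ν, p.μ⟩)⁻¹ : Matrix.specialUnitaryGroup (Fin N) ℂ) : Matrix (Fin N) (Fin N) ℂ))
          - (((GaugeField.plaqHol W p : Matrix.specialUnitaryGroup (Fin N) ℂ) : Matrix (Fin N) (Fin N) ℂ) * (Complex.I • D ⟨p.src, p.ν⟩)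
              * star ((GaugeField.plaqHol W p : Matrix.specialUnitaryGroup (Fin N) ℂ) : Matrix (Fin N) (Fin N) ℂ)))‖ ^ 2)
      ≤ 2 * 𝓡 + 8 * a ^ 2 * (P.d : ℝ) ^ 2 * t⁻¹ * ∑ b : PBond P i, ∑ a : Fin N, ∑ b' : Fin N,
          Complex.normSq (covD (torusT P i) (fun κ z => unitsField (toUField W) ⟨z, κ⟩) b.dir φ₀ b.src a b') := by
  -- the fast half, in the bond-sum currency
  have hF := plaqK_covD_fast_le_pbond W hW ht f hfast
    (fun b => covD (torusT P i) (fun κ z => unitsField (toUField W) ⟨z, κ⟩) b.dir f b.src) (fun b => rfl)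
  -- additivity
  have hadd := plaqK_covD_add_le W φ₀ s f hφ D Ds
    (fun b => covD (torusT P i) (fun κ z => unitsField (toUField W) ⟨z, κ⟩) b.dir f b.src) hD hDs (fun b => rfl)
  have ha2 : 0 ≤ 4 * a ^ 2 * ((P.d : ℝ) ^ 2 * t⁻¹) := by
    have : 0 ≤ t⁻¹ := inv_nonneg.mpr ht.le
    positivity
  calc _ ≤ _ := hadd
    _ ≤ 2 * 𝓡 + 2 * (4 * a ^ 2 * ((P.d : ℝ) ^ 2 * (t⁻¹ * ∑ b : PBond P i, ∑ a : Fin N, ∑ b' : Fin N,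
          Complex.normSq (covD (torusT P i) (fun κ z => unitsField (toUField W) ⟨z, κ⟩) b.dir f b.src a b')))) := by
        gcongr
    _ ≤ 2 * 𝓡 + 2 * (4 * a ^ 2 * ((P.d : ℝ) ^ 2 * (t⁻¹ * ∑ b : PBond P i, ∑ a : Fin N, ∑ b' : Fin N,
          Complex.normSq (covD (torusT P i) (fun κ z => unitsField (toUField W) ⟨z, κ⟩) b.dir φ₀ b.src a b')))) := by
        have : 0 ≤ t⁻¹ := inv_nonneg.mpr ht.le
        gcongr
    _ = _ := by ring

end Lattice

/-! ## §4 ★★★ The T³ reading over the spectral threshold split -/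

section T3

open T3ContinuumYM3Torus

/-- ★★★ **`hKg-K ⟸ hKg-K-SLOW` ON A T³ MEMBER.**  For every run `K` of a T³ family, `SU(2)` background `W` with `dist1(W(∂p)) ≤ a`, threshold `t > 0` and site field `φ₀` (the Hodge
potential of the engine) there are site fields `s f` with `φ₀ = s + f`, the three EXACT SPLITTINGS of ✓`exists_slow_fast_siteField_T3` re-exported (mass `Σ|φ₀|² = Σ|s|² + Σ|f|²`, Dirichlet energy
`Σ_b|D_Wφ₀|² = Σ_b|D_Ws|² + Σ_b|D_Wf|²`, Laplacian energy `Σ|Δ_Ws|² + Σ|Δ_Wf|² = Σ|Δ_Wφ₀|²` — so a consumer may restrict its displayed slow row to ENERGY-ORTHOGONAL splits, the class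
the numerics measured; review remark ym3-torus-px9 g3 2026-08-28 21:47Z), `s` SLOW (`Σ_b|D_Ws|²_HS ≤ t·Σ|s|²_HS`, `Σ|Δ_Ws|²_HS ≤ t·Σ_b|D_Ws|²_HS`) and `f` FAST (`t·Σ|f|²_HS ≤ Σ_b|D_Wf|²_HS`),
such that EVERY slow row `K_W(D_Ws) ≤ 𝓡` (the displayed R1-SLOW, at the door `𝓡 := C_g·K_W(Y) + θ_g·e·ℓ⁻²M(Y)`) yields `K_W(D_Wφ₀) ≤ 2𝓡 + 8a²d²t⁻¹·Σ_b|D_Wφ₀(b)|²_HS`.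
[cite: Balaban1985Variational, (6) p.278, (141)-(143) p.299, Prop. 7 p.299; Balaban1985BackgroundPropagators, (3.3)-(3.4) pp.390-391, (3.117)-(3.122) pp.419-420, Thm 3.11 p.416] -/
theorem hKgK_of_hKgK_slow_T3 (F : T3Family) (K : ℕ) (W : GaugeField (F.P K) 0 (Matrix.specialUnitaryGroup (Fin 2) ℂ)) {a t : ℝ}
    (hW : ∀ p : Plaq (F.P K) 0, dist1 (GaugeField.plaqHol W p) ≤ a) (ht : 0 < t)
    (φ₀ : Site (F.P K) 0 → Matrix (Fin 2) (Fin 2) ℂ) :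
    ∃ s f : Site (F.P K) 0 → Matrix (Fin 2) (Fin 2) ℂ,
      (∀ x, φ₀ x = s x + f x) ∧
      ∑ x : Site (F.P K) 0, ∑ a : Fin 2, ∑ b : Fin 2, Complex.normSq (φ₀ x a b)
        = ∑ x : Site (F.P K) 0, ∑ a : Fin 2, ∑ b : Fin 2, Complex.normSq (s x a b) + ∑ x : Site (F.P K) 0, ∑ a : Fin 2, ∑ b : Fin 2, Complex.normSq (f x a b) ∧
      ∑ b : PBond (F.P K) 0, ∑ a : Fin 2, ∑ b' : Fin 2, Complex.normSq (covD (torusT (F.P K) 0) (fun κ z => unitsField (toUField W) ⟨z, κ⟩) b.dir φ₀ b.src a b')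
        = ∑ b : PBond (F.P K) 0, ∑ a : Fin 2, ∑ b' : Fin 2, Complex.normSq (covD (torusT (F.P K) 0) (fun κ z => unitsField (toUField W) ⟨z, κ⟩) b.dir s b.src a b')
          + ∑ b : PBond (F.P K) 0, ∑ a : Fin 2, ∑ b' : Fin 2, Complex.normSq (covD (torusT (F.P K) 0) (fun κ z => unitsField (toUField W) ⟨z, κ⟩) b.dir f b.src a b') ∧
      ∑ x : Site (F.P K) 0, ∑ a : Fin 2, ∑ b : Fin 2, Complex.normSq (divB (torusT (F.P K) 0) (fun κ z => unitsField (toUField W) ⟨z, κ⟩)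
            (fun κ y => covD (torusT (F.P K) 0) (fun κ z => unitsField (toUField W) ⟨z, κ⟩) κ s y) x a b)
          + ∑ x : Site (F.P K) 0, ∑ a : Fin 2, ∑ b : Fin 2, Complex.normSq (divB (torusT (F.P K) 0) (fun κ z => unitsField (toUField W) ⟨z, κ⟩)
            (fun κ y => covD (torusT (F.P K) 0) (fun κ z => unitsField (toUField W) ⟨z, κ⟩) κ f y) x a b)
        = ∑ x : Site (F.P K) 0, ∑ a : Fin 2, ∑ b : Fin 2, Complex.normSq (divB (torusT (F.P K) 0) (fun κ z => unitsField (toUField W) ⟨z, κ⟩)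
            (fun κ y => covD (torusT (F.P K) 0) (fun κ z => unitsField (toUField W) ⟨z, κ⟩) κ φ₀ y) x a b) ∧
      ∑ b : PBond (F.P K) 0, ∑ a : Fin 2, ∑ b' : Fin 2, Complex.normSq (covD (torusT (F.P K) 0) (fun κ z => unitsField (toUField W) ⟨z, κ⟩) b.dir s b.src a b')
        ≤ t * ∑ x : Site (F.P K) 0, ∑ a : Fin 2, ∑ b : Fin 2, Complex.normSq (s x a b) ∧
      ∑ x : Site (F.P K) 0, ∑ a : Fin 2, ∑ b : Fin 2, Complex.normSq (divB (torusT (F.P K) 0) (fun κ z => unitsField (toUField W) ⟨z, κ⟩)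
          (fun κ y => covD (torusT (F.P K) 0) (fun κ z => unitsField (toUField W) ⟨z, κ⟩) κ s y) x a b)
        ≤ t * ∑ b : PBond (F.P K) 0, ∑ a : Fin 2, ∑ b' : Fin 2, Complex.normSq (covD (torusT (F.P K) 0) (fun κ z => unitsField (toUField W) ⟨z, κ⟩) b.dir s b.src a b') ∧
      t * ∑ x : Site (F.P K) 0, ∑ a : Fin 2, ∑ b : Fin 2, Complex.normSq (f x a b)
        ≤ ∑ b : PBond (F.P K) 0, ∑ a : Fin 2, ∑ b' : Fin 2, Complex.normSq (covD (torusT (F.P K) 0) (fun κ z => unitsField (toUField W) ⟨z, κ⟩) b.dir f b.src a b') ∧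
      ∀ (D Ds : PBond (F.P K) 0 → Matrix (Fin 2) (Fin 2) ℂ),
        (∀ b : PBond (F.P K) 0, D b = covD (torusT (F.P K) 0) (fun κ z => unitsField (toUField W) ⟨z, κ⟩) b.dir φ₀ b.src) →
        (∀ b : PBond (F.P K) 0, Ds b = covD (torusT (F.P K) 0) (fun κ z => unitsField (toUField W) ⟨z, κ⟩) b.dir s b.src) →
        ∀ 𝓡 : ℝ,
          (∑ p : Plaq (F.P K) 0, ‖((Complex.I • Ds ⟨p.src, p.μ⟩)
              + ((W ⟨p.src, p.μ⟩ : Matrix (Fin 2) (Fin 2) ℂ) * (Complex.I • Ds ⟨p.src.shift p.μ, p.ν⟩) * star (W ⟨p.src, p.μ⟩ : Matrix (Fin 2) (Fin 2) ℂ))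
              - (((W ⟨p.src, p.μ⟩ * W ⟨p.src.shift p.μ, p.ν⟩ * (W ⟨p.src.shift p.ν, p.μ⟩)⁻¹ : Matrix.specialUnitaryGroup (Fin 2) ℂ) : Matrix (Fin 2) (Fin 2) ℂ)
                  * (Complex.I • Ds ⟨p.src.shift p.ν, p.μ⟩)
                  * star ((W ⟨p.src, p.μ⟩ * W ⟨p.src.shift p.μ, p.ν⟩ * (W ⟨p.src.shift p.ν, p.μ⟩)⁻¹ : Matrix.specialUnitaryGroup (Fin 2) ℂ) : Matrix (Fin 2) (Fin 2) ℂ))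
              - (((GaugeField.plaqHol W p : Matrix.specialUnitaryGroup (Fin 2) ℂ) : Matrix (Fin 2) (Fin 2) ℂ) * (Complex.I • Ds ⟨p.src, p.ν⟩)
                  * star ((GaugeField.plaqHol W p : Matrix.specialUnitaryGroup (Fin 2) ℂ) : Matrix (Fin 2) (Fin 2) ℂ)))‖ ^ 2) ≤ 𝓡 →
          (∑ p : Plaq (F.P K) 0, ‖((Complex.I • D ⟨p.src, p.μ⟩)
              + ((W ⟨p.src, p.μ⟩ : Matrix (Fin 2) (Fin 2) ℂ) * (Complex.I • D ⟨p.src.shift p.μ, p.ν⟩) * star (W ⟨p.src, p.μ⟩ : Matrix (Fin 2) (Fin 2) ℂ))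
              - (((W ⟨p.src, p.μ⟩ * W ⟨p.src.shift p.μ, p.ν⟩ * (W ⟨p.src.shift p.ν, p.μ⟩)⁻¹ : Matrix.specialUnitaryGroup (Fin 2) ℂ) : Matrix (Fin 2) (Fin 2) ℂ)
                  * (Complex.I • D ⟨p.src.shift p.ν, p.μ⟩)
                  * star ((W ⟨p.src, p.μ⟩ * W ⟨p.src.shift p.μ, p.ν⟩ * (W ⟨p.src.shift p.ν, p.μ⟩)⁻¹ : Matrix.specialUnitaryGroup (Fin 2) ℂ) : Matrix (Fin 2) (Fin 2) ℂ))
              - (((GaugeField.plaqHol W p : Matrix.specialUnitaryGroup (Fin 2) ℂ) : Matrix (Fin 2) (Fin 2) ℂ) * (Complex.I • D ⟨p.src, p.ν⟩)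
                  * star ((GaugeField.plaqHol W p : Matrix.specialUnitaryGroup (Fin 2) ℂ) : Matrix (Fin 2) (Fin 2) ℂ)))‖ ^ 2)
            ≤ 2 * 𝓡 + 8 * a ^ 2 * ((F.P K).d : ℝ) ^ 2 * t⁻¹ * ∑ b : PBond (F.P K) 0, ∑ a : Fin 2, ∑ b' : Fin 2,
                Complex.normSq (covD (torusT (F.P K) 0) (fun κ z => unitsField (toUField W) ⟨z, κ⟩) b.dir φ₀ b.src a b') := by
  obtain ⟨s, f, hsum, hmass, hen, hslow, hslow2, hfast, hlap⟩ := exists_slow_fast_siteField_T3 F K W t φ₀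
  refine ⟨s, f, hsum, hmass, hen, hlap, hslow, hslow2, hfast, fun D Ds hD hDs 𝓡 hR => ?_⟩
  have hen' : ∑ b : PBond (F.P K) 0, ∑ a : Fin 2, ∑ b' : Fin 2,
        Complex.normSq (covD (torusT (F.P K) 0) (fun κ z => unitsField (toUField W) ⟨z, κ⟩) b.dir f b.src a b')
      ≤ ∑ b : PBond (F.P K) 0, ∑ a : Fin 2, ∑ b' : Fin 2,
        Complex.normSq (covD (torusT (F.P K) 0) (fun κ z => unitsField (toUField W) ⟨z, κ⟩) b.dir φ₀ b.src a b') := by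
    rw [hen]
    have : 0 ≤ ∑ b : PBond (F.P K) 0, ∑ a : Fin 2, ∑ b' : Fin 2,
        Complex.normSq (covD (torusT (F.P K) 0) (fun κ z => unitsField (toUField W) ⟨z, κ⟩) b.dir s b.src a b') :=
      Finset.sum_nonneg fun _ _ => Finset.sum_nonneg fun _ _ => Finset.sum_nonneg fun _ _ => Complex.normSq_nonneg _
    linarith
  exact plaqK_covD_le_of_slowRow W hW ht φ₀ s f hsum hfast hen' D Ds hD hDs hR

end T3

end Summit.QuantumFields.YangMills.Theorems.Prop7PlaqKSlowFastKnit

end
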